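import Summits.BirchSwinnertonDyer.Rank1Residual.GaloisImage.PropagatedStructure
import Literature.NumberTheory.EllipticCurves.TateModuleProjSurjectiveProofs
import HarnessLib

/-!
# Mazur–Rubin's propagated structure on `E[p^{k+1}]` is CARTESIAN at every place, and its residual
# structure is the level-one structure — the "cartesian" hypothesis of Sakamoto's Thm. 4.4 for the
# N11 instance, with no local-torsion, Tamagawa or reduction-type binder (cell `b2b-bsdres`, team
# n1011, sub-target T-a3-F1 hypothesis side, lead ruling R5-8 (c); §I item N11; seat p13)

HONEST FRAMING (cell `b2b-bsdres`, run/shared/lean/b2b/bsd-rank1-residual/, verbatim in every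
file): the goal of the cell is to DELETE the COMBINATION-SHAPED residual classes of the
Birch–Swinnerton-Dyer formula for ALL analytic-rank `≤ 1` elliptic curves over `ℚ` — "full BSD
formula for every rank `≤ 1` curve in class `C`" assembled STRICTLY from published theorems — so
that the rank-`≤ 1` remainder becomes exactly the CONSTRUCTION-SHAPED classes, which are TYPED
(missing-input `Prop`s), NOT attempted. This is not "finishing BSD". Team n1011: prove what is
provable now; shrink each hard class to its core with data; no claim beyond stated classes. Theorems
only (no definition, no named fact); nothing is booked; no label changes.

## What and why

Sakamoto, *The theory of Kolyvagin systems for `p = 3`*, JTNB 36 (2024), Thm. 4.4 (the `p = 3`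
input of the N11 chain behind Kim 2025) is stated for a Selmer structure `𝓕` on `T` that is
**cartesian** (Def. 3.5: for `𝔮 ∈ S(𝓕)` the map `H¹(K_𝔮, T̄)/H¹_𝓕̄(K_𝔮, T̄) → H¹(K_𝔮, T)/H¹_𝓕(K_𝔮, T)`
induced by the fixed injection `T̄ ↪ T` is injective; tree `SelmerStructure.IsCartesianAt`), of
core rank one and residually coisotropic. For the N11 instance — `K = ℚ`, `T = E[p^{k+1}]`,
`T̄ = E[p]`, `red = [p^k] : E[p^{k+1}] ↠ E[p]` (`WeierstrassCurve.torsionMulBy`),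
`incl : E[p] ↪ E[p^{k+1}]` (`WeierstrassCurve.torsionInclusion`), `𝓕 = propagatedSelmerStructure W p k`
(the canonical structure propagated from `T_pE`, sibling file `PropagatedStructure.lean`) — the
team's audit (skel/T-a3.md v2 §6 (b), (d); lead R5-8 (c)) says the structure is cartesian at every
place with NO hypothesis (unlike the structure relaxed at `p`, cartesian at `p` only when
`E(ℚ_p)[p] = 0` — Kim's `t = 0` device / v1's dropped binder (L)). This file proves it:

* `isCartesianAt_propagatedSelmerStructure` — **for every prime `p`, every `k`, every place `v` of
  `ℚ` (finite or infinite; good, bad or equal to `p`), `propagatedSelmerStructure W p k` is cartesian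
  at `v`** w.r.t. `([p^k], incl)`; `isCartesian_propagatedSelmerStructure` — on any finite set of
  places (Def. 3.5 verbatim); `isCartesian_propagatedSelmerStructure_three` — the N11 reading.
  PROOF (cocycle level; no `H²`, no long exact sequence, no duality): if
  `incl_*[ξ] = π_{k+1,*}[η]` then `incl ∘ ξ = π_{k+1} ∘ η + ∂t` for some `t ∈ E[p^{k+1}]`
  (`exists_sub_eq_of_oneCocycleClass_eq`); lift `t` to `t̃ ∈ T_pE` (`π_{k+1}` is onto,
  `proj_surjective_of_isAlgClosed_holds`) and replace `η` by `η − ∂t̃`; then `π_{k+1} ∘ η = incl ∘ ξ`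
  on the nose, so `η` takes values in `π_{k+1}⁻¹(E[p^{k+1}][p]) = p^k T_pE`; the quotient `η/p^k`
  is the shift `(a_{n+k})_n` (`tateDivPow`, continuous coordinatewise), again a continuous crossed
  homomorphism, and `[p^k] ∘ π_{k+1} ∘ (η/p^k) = π_1 ∘ (η/p^k) = ξ`, i.e.
  `[ξ] = [p^k]_* π_{k+1,*} [η/p^k] ∈ 𝓕̄_v`. This is skel/T-a3.md §6 (b) (`v = p`) AND (d) (`v ≠ p`,
  `p ∣ c_v` allowed — the row that leaned on Mazur–Rubin Lemma 3.7.1) for every row, in one stroke.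
* `localMap_torsionMulBy_tateLocalMap`, `induced_propagatedSelmerStructure` — **`𝓕̄ = 𝓕_can(E[p])`
  for every `k`**: the structure induced on `E[p]` along `[p^k]` (Sakamoto's `𝓕̄`, on which the
  CORE RANK (Def. 3.6, `LocalInvariants.HasCoreRank`) and RESIDUAL COISOTROPY (Def. 3.8) are
  evaluated) is `propagatedSelmerStructureOne W p = im(H¹(ℚ_v, T_pE) → H¹(ℚ_v, E[p]))`,
  independent of the level — so the two remaining hypotheses of Thm. 4.4 concern ONE structure on
  `E[p]` (the co-provers' targets, lead R5-3 / R5-8 (b)).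

What is NOT here: core rank one (local Euler characteristics — p04-g2), residual coisotropy
(Kummer image maximal isotropic — p18 lineage), anything about Kolyvagin systems themselves.

References: R. Sakamoto, JTNB 36 (2024) 919–946, Def. 3.5 (p. 923), Thm. 4.4 (p. 926)
[Sakamoto2024]; K. Rubin, PCMS 18 (2011) §3.1 (p. 29) [Rubin2011]; B. Mazur, K. Rubin, Mem. AMS
799 (2004) Def. 3.2.1, Lemma 3.7.1; C.-H. Kim, AJM 148 (2026) §2.1.6 [Kim2022StructureSelmer];
J. H. Silverman, *AEC* III.§7 [SilvermanAEC2009].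
-/

noncomputable section

open scoped Classical NumberField ContRepresentation
open Field NumberField IsDedekindDomain
open WeierstrassCurve Literature.NumberTheory.EllipticCurves Literature.NumberTheory.GaloisRepresentations
  Literature.NumberTheory.GaloisRepresentations.DiscreteGaloisModule

namespace Summit.BirchSwinnertonDyer.Rank1Residual.GaloisImage

variable (W : WeierstrassCurve ℚ) (p : ℕ) [hp : Fact p.Prime]

/-! ### The cartesian property at every place -/

section Main

variable [W.IsElliptic] (k : ℕ) (v : Place ℚ)

/-- **The propagated structure is cartesian at every place** (Sakamoto Def. 3.5, with
`red = [p^k] : E[p^{k+1}] → E[p]` and `incl : E[p] ↪ E[p^{k+1}]`): a class `x ∈ H¹(ℚ_v, E[p])` whose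
image under `incl_*` lies in `im(H¹(ℚ_v, T_pE) → H¹(ℚ_v, E[p^{k+1}]))` already lies in the induced
condition `[p^k]_*(im(H¹(ℚ_v, T_pE) → H¹(ℚ_v, E[p^{k+1}])))`. Cocycle-level proof: write
`incl ∘ ξ = π_{k+1} ∘ η + ∂t`, lift `t` to `T_pE` and absorb `∂t̃` into `η`; then `η` takes values in
`π_{k+1}⁻¹(E[p^{k+1}][p]) = p^k T_pE`, and `η / p^k` (the shift `tateDivPow`) is a continuous crossed
homomorphism with `[p^k] ∘ π_{k+1} ∘ (η / p^k) = ξ`. No hypothesis on `E(ℚ_v)[p]`, on Tamagawa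
numbers or on the reduction type: this is skel/T-a3.md §6 (b) (at `v = p`) and (d) (at `v ≠ p`)
for every row. [cite: Sakamoto2024, Def. 3.5 (p. 923)] -/
theorem isCartesianAt_propagatedSelmerStructure :
    (propagatedSelmerStructure W p k).IsCartesianAt
      (W.torsionMulBy ((p : ℤ) ^ k) (p : ℤ)) (W.torsionInclusion (Dvd.intro_left _ rfl)) v := by
  intro x hx
  obtain ⟨ξ, hξ⟩ := oneCocycleClass_surjective ((W.torsionGaloisModule (p : ℤ)).toLocal v).toTopRep x
  subst hξ
  obtain ⟨y, hy⟩ := (mem_propagatedSelmerStructure_iff W p k v _).mp hx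
  obtain ⟨η, hη⟩ := oneCocycleClass_surjective (tateLocalRep W p v).toTopRep y
  subst hη
  rw [tateLocalMap_oneCocycleClass, localMap_torsionInclusion_oneCocycleClass] at hy
  obtain ⟨t, ht⟩ := exists_sub_eq_of_oneCocycleClass_eq _ _ _ hy
  -- `ht g`, on underlying points: `(η g)_{k+1} - ξ g = g t - t`
  have ht' : ∀ g : absoluteGaloisGroup (Place.Completion v),
      TateModule.proj p (k + 1) (η.1 g) - ((ξ.1 g : geomTorsion W (p : ℤ)) : geomPoints W) =
        absGaloisRestrict ℚ (Place.Completion v) g • (t : geomPoints W) - (t : geomPoints W) := by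
    intro g
    exact congrArg (fun P : geomTorsion W ((p : ℤ) ^ k * (p : ℤ)) => (P : geomPoints W)) (ht g)
  -- lift `t` to `T_pE` and absorb its coboundary into `η`
  obtain ⟨tT, htT⟩ := proj_surjective_of_isAlgClosed_holds W p (k + 1)
    ((mem_geomTorsion_pow_mul_iff W p k _).mp t.2)
  set η' : contOneCocycles (tateLocalRep W p v).toTopRep :=
    η - principalCocycle _ tT (continuous_tateLocalRep_apply W p v tT) with hη'
  have hη'apply : ∀ g : absoluteGaloisGroup (Place.Completion v),
      η'.1 g = η.1 g - ((tateLocalRep W p v).toTopRep.ρ g tT - tT) := fun g => rfl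
  -- `(η' g)_{k+1} = ξ g`
  have hkey : ∀ g : absoluteGaloisGroup (Place.Completion v),
      TateModule.proj p (k + 1) (η'.1 g) = ((ξ.1 g : geomTorsion W (p : ℤ)) : geomPoints W) := by
    intro g
    rw [hη'apply, map_sub, map_sub, ContinuousRep.toTopRep_ρ_apply, tateLocalRep_apply_apply,
      TateModule.proj_smul_of_distribMulAction, htT, ← ht' g]
    abel
  -- hence `(η' g)_k = 0`
  have hk0 : ∀ g : absoluteGaloisGroup (Place.Completion v), TateModule.proj p k (η'.1 g) = 0 := by
    intro g
    rw [← TateModule.smul_proj_succ k (η'.1 g), hkey]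
    have hmem := (ξ.1 g).2
    rw [mem_geomTorsion_iff, natCast_zsmul] at hmem
    exact hmem
  -- the divided crossed homomorphism `η'' = η' / p^k`
  let f'' : absoluteGaloisGroup (Place.Completion v) → W.tateModule p :=
    fun g => tateDivPow k (η'.1 g) (hk0 g)
  have hf''val : ∀ (g : absoluteGaloisGroup (Place.Completion v)) (n : ℕ),
      TateModule.proj p n (f'' g) = TateModule.proj p (n + k) (η'.1 g) := fun g n => rfl
  have hcont'' : Continuous f'' :=
    continuous_induced_rng.2
      (continuous_pi fun n => (TateModule.continuous_proj (n + k)).comp η'.1.continuous)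
  have hcoc'' : ∀ g h : absoluteGaloisGroup (Place.Completion v),
      f'' (g * h) = f'' g + (tateLocalRep W p v).toTopRep.ρ g (f'' h) := by
    intro g h
    apply TateModule.ext
    intro n
    rw [hf''val, map_add, hf''val, ContinuousRep.toTopRep_ρ_apply, tateLocalRep_apply_apply,
      TateModule.proj_smul_of_distribMulAction, hf''val, η'.2 g h, map_add,
      ContinuousRep.toTopRep_ρ_apply, tateLocalRep_apply_apply,
      TateModule.proj_smul_of_distribMulAction]
  let η'' : contOneCocycles (tateLocalRep W p v).toTopRep := ⟨⟨f'', hcont''⟩, hcoc''⟩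
  have hη''apply : ∀ g : absoluteGaloisGroup (Place.Completion v), η''.1 g = f'' g := fun g => rfl
  -- conclude: `x = [ξ] = [p^k]_* π_* [η'']`
  refine (SelmerStructure.mem_induced_iff _ _ v _).mpr
    ⟨tateLocalMap W p k v (oneCocycleClass (tateLocalRep W p v).toTopRep η''),
      (mem_propagatedSelmerStructure_iff W p k v _).mpr ⟨_, rfl⟩, ?_⟩
  rw [tateLocalMap_oneCocycleClass, localMap_torsionMulBy_oneCocycleClass]
  congr 1
  apply Subtype.ext
  apply ContinuousMap.ext
  intro g
  apply Subtype.ext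
  rw [coe_redCocycle_apply, pushCocycle_apply, coe_tateToTorsion_apply, hη''apply, hf''val,
    ← hkey g, ← Nat.cast_pow, natCast_zsmul, add_comm (k + 1) k]
  exact TateModule.pow_smul_proj_self_add k (k + 1) (η'.1 g)

/-- **Cartesian on every finite set of places** (Sakamoto Def. 3.5 verbatim: "for any prime
`𝔮 ∈ S(𝓕)`"). [cite: Sakamoto2024, Def. 3.5 (p. 923)] -/
theorem isCartesian_propagatedSelmerStructure (S : Finset (Place ℚ)) :
    (propagatedSelmerStructure W p k).IsCartesian
      (W.torsionMulBy ((p : ℤ) ^ k) (p : ℤ)) (W.torsionInclusion (Dvd.intro_left _ rfl)) S :=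
  fun v _ => isCartesianAt_propagatedSelmerStructure W p k v
end Main

/-! ### The residual structure `𝓕̄` is the level-one propagated structure (independent of `k`) -/

section Residual

variable [W.IsElliptic] (k : ℕ) (v : Place ℚ)

/-- `[p^k] ∘ π_{k+1} = π_1` on crossed homomorphisms: `[p^k]_* (π_{k+1})_* [η] = (π_1)_* [η]`.
[folklore] -/
theorem localMap_torsionMulBy_tateLocalMap (η : contOneCocycles (tateLocalRep W p v).toTopRep) :
    DiscreteGaloisModule.localMap (W.torsionMulBy ((p : ℤ) ^ k) (p : ℤ)) v
        (tateLocalMap W p k v (oneCocycleClass (tateLocalRep W p v).toTopRep η)) =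
      tateLocalMapOne W p v (oneCocycleClass (tateLocalRep W p v).toTopRep η) := by
  rw [tateLocalMap_oneCocycleClass, localMap_torsionMulBy_oneCocycleClass,
    tateLocalMapOne_oneCocycleClass]
  congr 1
  apply Subtype.ext
  apply ContinuousMap.ext
  intro g
  apply Subtype.ext
  rw [coe_redCocycle_apply, pushCocycle_apply, coe_tateToTorsion_apply, pushCocycleOne_apply,
    coe_tateToTorsionOne_apply, ← Nat.cast_pow, natCast_zsmul]
  exact TateModule.pow_smul_proj_self_add k 1 (η.1 g)

/-- **`𝓕̄ = 𝓕_can(E[p])`, independent of the level**: the structure induced on `E[p]` from the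
propagated structure on `E[p^{k+1}]` along `red = [p^k]` (Sakamoto's `𝓕̄`, on which the core rank
and residual coisotropy are evaluated) is the level-one propagated structure
`im(H¹(ℚ_v, T_pE) → H¹(ℚ_v, E[p]))`, for every `k`. [cite: Sakamoto2024, §2 (p. 921), the induced Selmer structure] -/
theorem induced_propagatedSelmerStructure (k : ℕ) :
    (propagatedSelmerStructure W p k).induced (W.torsionMulBy ((p : ℤ) ^ k) (p : ℤ)) =
      propagatedSelmerStructureOne W p := by
  funext v
  refine AddSubgroup.ext fun x => ⟨fun hx => ?_, fun hx => ?_⟩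
  · obtain ⟨y, hy, rfl⟩ := (SelmerStructure.mem_induced_iff _ _ v x).mp hx
    obtain ⟨z, rfl⟩ := (mem_propagatedSelmerStructure_iff W p k v y).mp hy
    obtain ⟨η, rfl⟩ := oneCocycleClass_surjective (tateLocalRep W p v).toTopRep z
    exact (mem_propagatedSelmerStructureOne_iff W p v _).mpr
      ⟨_, (localMap_torsionMulBy_tateLocalMap W p k v η).symm⟩
  · obtain ⟨z, rfl⟩ := (mem_propagatedSelmerStructureOne_iff W p v x).mp hx
    obtain ⟨η, rfl⟩ := oneCocycleClass_surjective (tateLocalRep W p v).toTopRep z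
    exact (SelmerStructure.mem_induced_iff _ _ v _).mpr
      ⟨tateLocalMap W p k v (oneCocycleClass (tateLocalRep W p v).toTopRep η),
        (mem_propagatedSelmerStructure_iff W p k v _).mpr ⟨_, rfl⟩,
        localMap_torsionMulBy_tateLocalMap W p k v η⟩
end Residual

/-! ### The N11 instance: `p = 3` -/

section Three

variable [W.IsElliptic]

/-- **N11 reading (`p = 3`, every level `3^{k+1}`, every place, every row)**: the Mazur–Rubin
propagated structure on `E[3^{k+1}]` is cartesian with respect to `(E[3^{k+1}] ↠ E[3], E[3] ↪ E[3^{k+1}])`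
on any finite set of places — the "cartesian" hypothesis of Sakamoto's Thm. 4.4 for the N11
instance holds with NO local-torsion (`E(ℚ₃)[3] = 0`), Tamagawa or reduction-type binder
(skel/T-a3.md §6 (b), (d)). [cite: Sakamoto2024, Def. 3.5 (p. 923) and Thm. 4.4 (p. 926), hypothesis "cartesian"] -/
theorem isCartesian_propagatedSelmerStructure_three (k : ℕ) (S : Finset (Place ℚ)) :
    (propagatedSelmerStructure W 3 k).IsCartesian
      (W.torsionMulBy ((3 : ℤ) ^ k) (3 : ℤ)) (W.torsionInclusion (Dvd.intro_left _ rfl)) S := by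
  haveI : Fact (Nat.Prime 3) := ⟨Nat.prime_three⟩
  exact isCartesian_propagatedSelmerStructure W 3 k S

end Three
end Summit.BirchSwinnertonDyer.Rank1Residual.GaloisImage

end
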